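import Mathlib
import Summits.Ventures.HodgeRepro2.Tier7.Line1.SepDatum
import Summits.Ventures.HodgeRepro2.Tier7.Common.TwoTorus

/-!
# Tier7/Line1/SepRtf — the separating datum separates `C(D)` from LINE 3's residual `RtfConclusion D` too
(seat t7-L1-p2, gen 4; REPAIR-CENSUS §B5.6 / §C U5 — closed BY COMPOSITION, as t7-plan-1 l. 15524 observed)

`Sep.datumS` (Tier7/Line1/SepDatum.lean, p674249) is a `PeriodDatum` with `C(D)` TRUE (`conclusion_datumS`:
`L2 (f^*Ω_s 1) (f^*Ω_s̄ 1) = 1`) and `Line1.CommonIrred D` FALSE (`not_commonIrred`). Since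
`Common.commonIrred_of_rtfConclusion : Line3.RtfConclusion D → Line1.CommonIrred D` is UNCONDITIONAL on every
datum (Tier7/Common/TwoTorus.lean, p661845: plan-2's `commonIrred_of_TT` through `Line3.density`), the same datum
has `Line3.RtfConclusion D` FALSE:

* `not_rtfConclusion : ¬ Line3.RtfConclusion datumS` (the contrapositive);
* `separating_rtf : C(datumS) ∧ ¬ Line3.RtfConclusion datumS`;
* `not_conclusion_imp_rtfConclusion`: over the abstract datum, `C(D) → Line3.RtfConclusion D` is FALSE — the
  binder shape of `Sep.not_conclusion_imp_commonIrred`.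

Consequence for the record (plan-3's census §B5.6): LINE 3's residual over the abstract datum is a GENUINE
reduction (not `≡ C(D)` everywhere), exactly as LINE 1's, and `≡ C(D)` on printed data (p666013 / p666660). Nothing
here is about the real `X`, (N) or (P); no sorry; axioms ⊆ {propext, Classical.choice, Quot.sound}.
-/

namespace Summit.Ventures.HodgeRepro2.Tier7.Line1.Sep

open Summit.Ventures.HodgeRepro2 Summit.Ventures.HodgeRepro2.T6 Summit.Ventures.HodgeRepro2.Tier7

/-- **`RtfConclusion` FAILS for the separating datum** — the contrapositive of the unconditional bridge
`Common.commonIrred_of_rtfConclusion` applied to `not_commonIrred`. -/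
theorem not_rtfConclusion : ¬ Line3.RtfConclusion datumS := fun h =>
  not_commonIrred (Common.commonIrred_of_rtfConclusion datumS h)

/-- **THE SEPARATION for LINE 3**: `C(D)` holds and `Line3.RtfConclusion D` fails on `datumS`. -/
theorem separating_rtf :
    (∃ g : Fin 4 → G, datumS.S.L2 (datumS.fOmegaS g) (datumS.fOmegaSbar g) ≠ 0) ∧
      ¬ Line3.RtfConclusion datumS :=
  ⟨conclusion_datumS, not_rtfConclusion⟩

/-- **THE LINE-3 RESIDUAL PROBE**: over the abstract datum, `C(D) → Line3.RtfConclusion D` is FALSE. -/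
theorem not_conclusion_imp_rtfConclusion :
    ¬ ∀ (K : Type) [Field K] [NumberField K] (E' : Type) [Field E'] [NumberField E']
      (V : Type) [AddCommGroup V] [Module E' V] (HX : Type) [Ring HX] [Algebra ℂ HX]
      (G : Type) [Group G] [MulAction G HX] (D : PeriodDatum K E' V HX G),
      (∃ g : Fin 4 → G, D.S.L2 (D.fOmegaS g) (D.fOmegaSbar g) ≠ 0) → Line3.RtfConclusion D :=
  fun h => not_rtfConclusion (h K7 K7 (Fin 3 → K7) HXK G datumS conclusion_datumS)

end Summit.Ventures.HodgeRepro2.Tier7.Line1.Sep
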